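/-
Copyright (c) 2026. All rights reserved.
Released under Apache 2.0 license as described in the file LICENSE.
-/
import Mathlib
import Summits.RiemannHypothesis.RiemannHypothesis.Theorems.HandoffLatticeTailFloor
import HarnessLib

/-!
# THEOREM F2: the one-zero floor with an intrinsic DEPTH SCALE (weighted tail)

`HANDOFF/prove-1` gen15, ATTEMPT-22 §8. Same setting as `HandoffLatticeTailFloor` (`F` Lipschitz on
`[0, λ]`, `λ ≥ 1`, vanishing beyond `λ`, `∫_0^λ F = 0`; `θ_F = dilationSum λ F`, `T = latticeTail λ F`,
`W(γ)` the window transform at a critical zero). For `0 < κ < 1/2` put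

  `T^{(κ)} := ∫_{(0,1/λ]} ‖θ_F(u)‖² u^{-2κ} du`   (the `κ`-WEIGHTED tail; finite, `θ_F` being bounded).

* `norm_windowMellin_le_weighted` — for every `A > 0`:
  `‖W(γ)‖ ≤ (e^{-A}/λ)^κ (2κ)^{-1/2} √(T^{(κ)}) + √(A·T)`
  (the part of the tail deeper than `e^{-A}/λ` is bounded by WEIGHTED Cauchy–Schwarz instead of
  the sup norm).
* `latticeTail_ge_of_depthScale` — if `T^{(κ)} ≤ Λ^{2κ}·T` for some `Λ ≥ λ` (read: «the tail's
  energy sits above depth `1/Λ`»), then with `A = log(Λ/λ) + 1`: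
  `T ≥ ‖W(γ)‖² / (√(log(Λ/λ) + 1) + e^{-κ}(2κ)^{-1/2})²`.

So idea-1's chain (IDEAS-prolate §131.3) splits into a THEOREM (this file: floor given a depth scale,
RH-free, unconditional) and a separate CONJECTURE ((DEPTH): `Λ_κ(F*) ≤ C·λ·q^{a}` for slaved
near-null vectors, their capacity law `A95 = log(1.5q) + 0.12`), which would turn the floor into
`T ≳ ‖W‖²/((1+a)ℓ)` — the shape of the `1/ℓ` law. Nothing here bears on the truth of RH.
-/

noncomputable section

set_option linter.dupNamespace false

open Complex MeasureTheory Set Filter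
open Literature.NumberTheory.LFunctions
open scoped NNReal

namespace Summit.RiemannHypothesis.RiemannHypothesis.Theorems

namespace LatticeUncertainty

variable {lam : ℝ} {F : ℝ → ℂ}

section FloorWeighted

variable (hlam : 1 ≤ lam) (hFm : Measurable F) {B : ℝ} (hB : ∀ u, ‖dilationSum lam F u‖ ≤ B)
  (hMuntz : ∀ s : ℂ, 0 < s.re → s ≠ 1 → mellin (dilationSum lam F) s = riemannZeta s * mellin F s)
include hlam hFm hB

omit hlam in
/-- The `κ`-weighted tail integrand `‖θ_F(u)‖² u^{-2κ}` is integrable on `(0, 1/λ]` for `κ < 1/2`. -/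
theorem integrableOn_weightedTail {κ : ℝ} (hκ : κ < 1 / 2) :
    IntegrableOn (fun u : ℝ ↦ ‖dilationSum lam F u‖ ^ 2 * u ^ (-(2 * κ))) (Ioc 0 (1 / lam)) := by
  have h0 : 0 ≤ B := (norm_nonneg _).trans (hB 0)
  have hg : IntegrableOn (fun u : ℝ ↦ B ^ 2 * u ^ (-(2 * κ))) (Ioc 0 (1 / lam)) :=
    ((intervalIntegral.intervalIntegrable_rpow' (a := 0) (b := 1 / lam)
      (by linarith : (-1 : ℝ) < -(2 * κ))).1).const_mul _
  refine Integrable.mono' hg ?_ ?_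
  · exact ((((measurable_dilationSum hFm lam).norm).pow_const 2).mul
      (measurable_id.pow_const _)).aestronglyMeasurable
  · refine (ae_restrict_iff' measurableSet_Ioc).mpr (Eventually.of_forall fun u hu ↦ ?_)
    rw [Real.norm_of_nonneg (by positivity [Real.rpow_nonneg hu.1.le (-(2 * κ))])]
    exact mul_le_mul_of_nonneg_right (pow_le_pow_left₀ (norm_nonneg _) (hB u) 2)
      (Real.rpow_nonneg hu.1.le _)

include hMuntz in
/-- **THEOREM F2 (master inequality with the weighted tail).** For every critical zero `½ + iγ`,
every `A > 0` and every `0 < κ < 1/2`: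
`‖W(γ)‖ ≤ (e^{-A}/λ)^κ (2κ)^{-1/2} √(T^{(κ)}) + √(A · T)`. -/
theorem norm_windowMellin_le_weighted {γ : ℝ} (hγ : riemannZeta (1 / 2 + γ * I) = 0) {A : ℝ}
    (hA : 0 < A) {κ : ℝ} (hκ0 : 0 < κ) (hκ : κ < 1 / 2) :
    ‖mellin ((Ioi (1 / lam)).indicator (dilationSum lam F)) (1 / 2 + γ * I)‖ ≤
      (Real.exp (-A) / lam) ^ κ / Real.sqrt (2 * κ) *
          Real.sqrt (∫ u in Ioc 0 (1 / lam), ‖dilationSum lam F u‖ ^ 2 * u ^ (-(2 * κ))) +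
        Real.sqrt (A * latticeTail lam F) := by
  set θ := dilationSum lam F with hθ
  set η : ℝ := Real.exp (-A) / lam with hη_def
  set Tk : ℝ := ∫ u in Ioc 0 (1 / lam), ‖θ u‖ ^ 2 * u ^ (-(2 * κ)) with hTk
  have hlam0 : 0 < lam := by positivity
  have hη0 : 0 < η := by positivity
  have hηl : η < 1 / lam := by
    rw [hη_def, div_lt_div_iff_of_pos_right hlam0]
    exact Real.exp_lt_one_iff.mpr (by linarith)
  have hlogeta : Real.log (1 / lam / η) = A := by
    rw [hη_def, div_div_eq_mul_div, one_div, inv_mul_eq_div, div_self hlam0.ne', one_div,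
      Real.log_inv, Real.log_exp, neg_neg]
  have hmaster := norm_windowMellin_le_deep_add hlam hFm hB hMuntz hγ hη0 hηl
  rw [hlogeta] at hmaster
  have hI1 := integrableOn_cpow_smul_dilationSum hFm hB γ (b := η) le_rfl
  -- the weighted-tail integrand and its pieces
  have hTkint := integrableOn_weightedTail hFm hB hκ
  set Tk1 : ℝ := ∫ u in Ioc 0 η, ‖θ u‖ ^ 2 * u ^ (-(2 * κ)) with hTk1
  have hTk1le : Tk1 ≤ Tk :=
    setIntegral_mono_set hTkint (Eventually.of_forall fun u ↦ by
        simp only [Pi.zero_apply]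
        rcases le_or_gt u 0 with h | h
        · have : ⌊lam / u⌋₊ = 0 := Nat.floor_eq_zero.mpr (by
            have := div_nonpos_of_nonneg_of_nonpos hlam0.le h; linarith)
          simp [hθ, dilationSum, this]
        · positivity)
      (Eventually.of_forall (Ioc_subset_Ioc_right hηl.le))
  have hTk10 : 0 ≤ Tk1 := setIntegral_nonneg measurableSet_Ioc fun u hu ↦ by
    have := hu.1; positivity
  -- THE DEEP PART, weighted Cauchy–Schwarz: `≤ √(η^{2κ}/(2κ) · Tk1)`
  have hdeep : ‖∫ u in Ioc 0 η, (u : ℂ) ^ ((1 / 2 + γ * I : ℂ) - 1) • θ u‖ ≤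
      Real.sqrt (η ^ (2 * κ) / (2 * κ) * Tk1) := by
    have hX : ‖∫ u in Ioc 0 η, (u : ℂ) ^ ((1 / 2 + γ * I : ℂ) - 1) • θ u‖ ≤
        ∫ u in Ioc 0 η, u ^ (-(1 / 2 : ℝ)) * ‖θ u‖ := by
      refine (norm_integral_le_integral_norm _).trans (le_of_eq ?_)
      exact setIntegral_congr_fun measurableSet_Ioc fun u hu ↦ norm_cpow_smul_dilationSum γ hu.1
    have hG : 0 < η ^ (2 * κ) / (2 * κ) := by positivity
    refine le_sqrt_mul_of_forall_amgm hG hTk10 fun t ht ↦ hX.trans ?_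
    -- `u^{-1/2}‖θ‖ = u^{κ-1/2} · (‖θ‖ u^{-κ}) ≤ (t u^{2κ-1} + ‖θ‖² u^{-2κ}/t)/2`
    have hpow : IntegrableOn (fun u : ℝ ↦ u ^ (2 * κ - 1)) (Ioc 0 η) :=
      (intervalIntegral.intervalIntegrable_rpow' (a := 0) (b := η) (by linarith : (-1:ℝ) < 2*κ-1)).1
    have hTk1int : IntegrableOn (fun u : ℝ ↦ ‖θ u‖ ^ 2 * u ^ (-(2 * κ))) (Ioc 0 η) :=
      hTkint.mono_set (Ioc_subset_Ioc_right hηl.le)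
    have hmono : ∫ u in Ioc 0 η, u ^ (-(1 / 2 : ℝ)) * ‖θ u‖ ≤
        ∫ u in Ioc 0 η, (t * u ^ (2 * κ - 1) + ‖θ u‖ ^ 2 * u ^ (-(2 * κ)) / t) / 2 := by
      refine setIntegral_mono_on ?_ (((hpow.const_mul t).add (hTk1int.div_const t)).div_const 2)
        measurableSet_Ioc fun u hu ↦ ?_
      · have hI1n : IntegrableOn (fun u : ℝ ↦ ‖(u : ℂ) ^ ((1 / 2 + γ * I : ℂ) - 1) • θ u‖)
            (Ioc 0 η) := hI1.norm
        exact hI1n.congr_fun (fun u hu ↦ norm_cpow_smul_dilationSum γ hu.1) measurableSet_Ioc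
      · have hu0 : 0 < u := hu.1
        set a : ℝ := u ^ (κ - 1 / 2) with ha
        set b : ℝ := ‖θ u‖ * u ^ (-κ) with hb
        have hab : u ^ (-(1 / 2 : ℝ)) * ‖θ u‖ = a * b := by
          rw [ha, hb, mul_comm (‖θ u‖), ← mul_assoc, ← Real.rpow_add hu0]
          ring_nf
        have ha2 : a ^ 2 = u ^ (2 * κ - 1) := by
          rw [ha, ← Real.rpow_natCast, ← Real.rpow_mul hu0.le]
          congr 1; push_cast; ring
        have hk2 : (u ^ (-κ)) ^ 2 = u ^ (-(2 * κ)) := by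
          rw [← Real.rpow_natCast, ← Real.rpow_mul hu0.le]
          congr 1; push_cast; ring
        have hb2 : b ^ 2 = ‖θ u‖ ^ 2 * u ^ (-(2 * κ)) := by rw [hb, mul_pow, hk2]
        have hst : Real.sqrt t ^ 2 = t := Real.sq_sqrt ht.le
        have hst0 : 0 < Real.sqrt t := Real.sqrt_pos.mpr ht
        have key : 0 ≤ (Real.sqrt t * a - b / Real.sqrt t) ^ 2 := sq_nonneg _
        have e : (Real.sqrt t * a - b / Real.sqrt t) ^ 2 =
            Real.sqrt t ^ 2 * a ^ 2 + b ^ 2 / Real.sqrt t ^ 2 - 2 * (a * b) := by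
          field_simp; ring
        rw [e, hst, ha2, hb2] at key
        rw [hab]
        linarith
    refine hmono.trans (le_of_eq ?_)
    rw [integral_div, integral_add (hpow.const_mul t) (hTk1int.div_const t), integral_const_mul,
      integral_div, ← hTk1, ← intervalIntegral.integral_of_le hη0.le,
      integral_rpow (Or.inl (by linarith)), Real.zero_rpow (by linarith),
      show (2 * κ - 1 + 1 : ℝ) = 2 * κ by ring]
    ring
  -- assemble: `√(η^{2κ}/(2κ) Tk1) ≤ η^κ/√(2κ) · √Tk`
  have hdeep' : Real.sqrt (η ^ (2 * κ) / (2 * κ) * Tk1) ≤ η ^ κ / Real.sqrt (2 * κ) * Real.sqrt Tk := by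
    rw [Real.sqrt_mul (by positivity), Real.sqrt_div (by positivity),
      show η ^ (2 * κ) = (η ^ κ) ^ 2 by
        rw [← Real.rpow_natCast, ← Real.rpow_mul hη0.le]; congr 1; push_cast; ring,
      Real.sqrt_sq (by positivity)]
    gcongr
  exact hmaster.trans (add_le_add (hdeep.trans hdeep') le_rfl)

include hMuntz in
/-- **THEOREM F2 (floor with a depth scale).** If the `κ`-weighted tail is at most `Λ^{2κ}` times
the tail, `T^{(κ)} ≤ Λ^{2κ} T` with `Λ ≥ λ` (the tail's energy sits above depth `1/Λ`), then for every
critical zero: `T ≥ ‖W(γ)‖² / (√(log(Λ/λ) + 1) + e^{-κ}/√(2κ))²`. Unconditional and RH-free; the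
programme's (DEPTH) conjecture is the separate claim `Λ ≲ λ·q^{a}` for slaved near-null vectors. -/
theorem latticeTail_ge_of_depthScale {γ : ℝ} (hγ : riemannZeta (1 / 2 + γ * I) = 0) {κ : ℝ}
    (hκ0 : 0 < κ) (hκ : κ < 1 / 2) {Λ : ℝ} (hΛ : lam ≤ Λ)
    (hdepth : ∫ u in Ioc 0 (1 / lam), ‖dilationSum lam F u‖ ^ 2 * u ^ (-(2 * κ)) ≤
      Λ ^ (2 * κ) * latticeTail lam F) :
    ‖mellin ((Ioi (1 / lam)).indicator (dilationSum lam F)) (1 / 2 + γ * I)‖ ^ 2 /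
        (Real.sqrt (Real.log (Λ / lam) + 1) + Real.exp (-κ) / Real.sqrt (2 * κ)) ^ 2
      ≤ latticeTail lam F := by
  set w := ‖mellin ((Ioi (1 / lam)).indicator (dilationSum lam F)) (1 / 2 + γ * I)‖ with hw_def
  set T := latticeTail lam F with hT_def
  set Tk : ℝ := ∫ u in Ioc 0 (1 / lam), ‖dilationSum lam F u‖ ^ 2 * u ^ (-(2 * κ)) with hTk
  have hlam0 : 0 < lam := by positivity
  have hΛ0 : 0 < Λ := hlam0.trans_le hΛ
  have hlog : 0 ≤ Real.log (Λ / lam) := Real.log_nonneg ((one_le_div hlam0).mpr hΛ)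
  set A : ℝ := Real.log (Λ / lam) + 1 with hA_def
  have hA : 0 < A := by positivity
  have hT0 : 0 ≤ T := integral_nonneg fun u ↦ by positivity
  have hmaster := norm_windowMellin_le_weighted hlam hFm hB hMuntz hγ hA hκ0 hκ
  rw [← hw_def, ← hTk, ← hT_def] at hmaster
  -- `(e^{-A}/λ)^κ = (e^{-1}/Λ)^κ` and `(e^{-1}/Λ)^κ √Tk ≤ e^{-κ} √T`
  have hexp : Real.exp (-A) / lam = Real.exp (-1) / Λ := by
    rw [hA_def, neg_add, Real.exp_add, Real.exp_neg, Real.exp_log (by positivity)]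
    field_simp
  have hdeep : (Real.exp (-A) / lam) ^ κ / Real.sqrt (2 * κ) * Real.sqrt Tk ≤
      Real.exp (-κ) / Real.sqrt (2 * κ) * Real.sqrt T := by
    rw [hexp, Real.div_rpow (Real.exp_pos _).le hΛ0.le, ← Real.exp_mul, show (-1 : ℝ) * κ = -κ by ring]
    have h1 : Real.sqrt Tk ≤ Λ ^ κ * Real.sqrt T := by
      calc Real.sqrt Tk ≤ Real.sqrt (Λ ^ (2 * κ) * T) := Real.sqrt_le_sqrt hdepth
        _ = Λ ^ κ * Real.sqrt T := by
          rw [Real.sqrt_mul (by positivity), show Λ ^ (2 * κ) = (Λ ^ κ) ^ 2 by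
            rw [← Real.rpow_natCast, ← Real.rpow_mul hΛ0.le]; congr 1; push_cast; ring,
            Real.sqrt_sq (by positivity)]
    have hΛκ : 0 < Λ ^ κ := Real.rpow_pos_of_pos hΛ0 κ
    calc Real.exp (-κ) / Λ ^ κ / Real.sqrt (2 * κ) * Real.sqrt Tk
        ≤ Real.exp (-κ) / Λ ^ κ / Real.sqrt (2 * κ) * (Λ ^ κ * Real.sqrt T) := by gcongr
      _ = Real.exp (-κ) / Real.sqrt (2 * κ) * Real.sqrt T := by field_simp
  have hmain : w ≤ (Real.sqrt A + Real.exp (-κ) / Real.sqrt (2 * κ)) * Real.sqrt T := by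
    have := hmaster.trans (add_le_add hdeep le_rfl)
    rw [Real.sqrt_mul hA.le] at this
    linarith
  set D := Real.sqrt A + Real.exp (-κ) / Real.sqrt (2 * κ) with hD
  have hD0 : 0 < D := by positivity
  have hw0 : 0 ≤ w := norm_nonneg _
  have h2 : w ^ 2 ≤ D ^ 2 * T := by
    calc w ^ 2 ≤ (D * Real.sqrt T) ^ 2 := by gcongr
      _ = D ^ 2 * T := by rw [mul_pow, Real.sq_sqrt hT0]
  rw [div_le_iff₀ (pow_pos hD0 2)]
  linarith

include hMuntz in
/-- **Fibre depth (contrapositive of THEOREM F2).** The window transform `W(γ)` depends only on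
the window datum (`θ_F` on `[1/λ, λ]` involves `F` on `[1/λ, λ]` only), so on a fibre it is FIXED;
hence any completion whose tail is smaller than `‖W(γ)‖²/(√(log(Λ/λ)+1) + e^{-κ}/√(2κ))²` must
have `κ`-weighted tail `> Λ^{2κ}·T`: small tails (THEOREM N(a)'s Beurling approximants, THEOREM
U0's vectors) force a large DEPTH SCALE, quantitatively. -/
theorem weightedTail_gt_of_latticeTail_lt {γ : ℝ} (hγ : riemannZeta (1 / 2 + γ * I) = 0) {κ : ℝ}
    (hκ0 : 0 < κ) (hκ : κ < 1 / 2) {Λ : ℝ} (hΛ : lam ≤ Λ)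
    (hT : latticeTail lam F <
      ‖mellin ((Ioi (1 / lam)).indicator (dilationSum lam F)) (1 / 2 + γ * I)‖ ^ 2 /
        (Real.sqrt (Real.log (Λ / lam) + 1) + Real.exp (-κ) / Real.sqrt (2 * κ)) ^ 2) :
    Λ ^ (2 * κ) * latticeTail lam F <
      ∫ u in Ioc 0 (1 / lam), ‖dilationSum lam F u‖ ^ 2 * u ^ (-(2 * κ)) := by
  by_contra h
  exact absurd (latticeTail_ge_of_depthScale hlam hFm hB hMuntz hγ hκ0 hκ hΛ (not_lt.mp h))
    (not_le.mpr hT)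

include hMuntz in
/-- **THEOREM F3 (floor from pointwise TAIL DECAY).** If `‖θ_F(u)‖ ≤ E·u^{m−1}` on `(0, 1/Λ]`
(`m > ½`, `Λ ≥ λ` — by L-DUAL this is SPECTRAL DECAY `‖𝓕F(ξ)‖ ≤ D·ξ^{−m}` of the leakage beyond
`Λ`, with `E = D·ζ(m)`, file `HandoffLatticeTailFloorSpectral`), then for every `A > 0` with
`A ≥ log(Λ/λ)`: `‖W(γ)‖ ≤ E/(m−½)·(e^{−A}/λ)^{m−½} + √(A·T)`. -/
theorem norm_windowMellin_le_of_tailDecay {γ : ℝ} (hγ : riemannZeta (1 / 2 + γ * I) = 0)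
    {Λ E m : ℝ} (hm : 1 / 2 < m) (hΛ : lam ≤ Λ)
    (hθ : ∀ u ∈ Ioc 0 (1 / Λ), ‖dilationSum lam F u‖ ≤ E * u ^ (m - 1)) {A : ℝ} (hA : 0 < A)
    (hAΛ : Real.log (Λ / lam) ≤ A) :
    ‖mellin ((Ioi (1 / lam)).indicator (dilationSum lam F)) (1 / 2 + γ * I)‖ ≤
      E / (m - 1 / 2) * (Real.exp (-A) / lam) ^ (m - 1 / 2) +
        Real.sqrt (A * latticeTail lam F) := by
  set η : ℝ := Real.exp (-A) / lam with hη_def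
  have hlam0 : 0 < lam := by positivity
  have hΛ0 : 0 < Λ := hlam0.trans_le hΛ
  have hη0 : 0 < η := by positivity
  have hηl : η < 1 / lam := by
    rw [hη_def, div_lt_div_iff_of_pos_right hlam0]
    exact Real.exp_lt_one_iff.mpr (by linarith)
  have hηΛ : η ≤ 1 / Λ := by
    -- `e^{-A} ≤ e^{-log(Λ/λ)} = λ/Λ`
    have h1 : Real.exp (-A) ≤ lam / Λ := by
      calc Real.exp (-A) ≤ Real.exp (-Real.log (Λ / lam)) :=
            Real.exp_le_exp.mpr (neg_le_neg hAΛ)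
        _ = lam / Λ := by rw [Real.exp_neg, Real.exp_log (by positivity), inv_div]
    rw [hη_def, div_le_iff₀ hlam0]
    calc Real.exp (-A) ≤ lam / Λ := h1
      _ = 1 / Λ * lam := by ring
  have hlogeta : Real.log (1 / lam / η) = A := by
    rw [hη_def, div_div_eq_mul_div, one_div, inv_mul_eq_div, div_self hlam0.ne', one_div,
      Real.log_inv, Real.log_exp, neg_neg]
  have hE : 0 ≤ E := by
    have h := hθ (1 / Λ) ⟨by positivity, le_rfl⟩
    have hp : 0 < (1 / Λ) ^ (m - 1) := Real.rpow_pos_of_pos (by positivity) _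
    nlinarith [norm_nonneg (dilationSum lam F (1 / Λ))]
  have hmaster := norm_windowMellin_le_deep_add hlam hFm hB hMuntz hγ hη0 hηl
  rw [hlogeta] at hmaster
  have hm' : -1 < m - 3 / 2 := by linarith
  have hdeep : ‖∫ u in Ioc 0 η, (u : ℂ) ^ ((1 / 2 + γ * I : ℂ) - 1) • dilationSum lam F u‖ ≤
      E / (m - 1 / 2) * η ^ (m - 1 / 2) := by
    have hg : IntegrableOn (fun u : ℝ ↦ E * u ^ (m - 3 / 2)) (Ioc 0 η) :=
      ((intervalIntegral.intervalIntegrable_rpow' (a := 0) (b := η) hm').1).const_mul _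
    have h1 : ‖∫ u in Ioc 0 η, (u : ℂ) ^ ((1 / 2 + γ * I : ℂ) - 1) • dilationSum lam F u‖ ≤
        ∫ u in Ioc 0 η, E * u ^ (m - 3 / 2) := by
      refine norm_integral_le_of_norm_le hg ?_
      refine (ae_restrict_iff' measurableSet_Ioc).mpr (Eventually.of_forall fun u hu ↦ ?_)
      rw [norm_cpow_smul_dilationSum γ hu.1]
      have hb := hθ u ⟨hu.1, hu.2.trans hηΛ⟩
      calc u ^ (-(1 / 2 : ℝ)) * ‖dilationSum lam F u‖ ≤ u ^ (-(1 / 2 : ℝ)) * (E * u ^ (m - 1)) :=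
            mul_le_mul_of_nonneg_left hb (Real.rpow_nonneg hu.1.le _)
        _ = E * u ^ (m - 3 / 2) := by
            rw [mul_left_comm, ← Real.rpow_add hu.1]; ring_nf
    have h2 : ∫ u in Ioc 0 η, E * u ^ (m - 3 / 2) = E / (m - 1 / 2) * η ^ (m - 1 / 2) := by
      rw [integral_const_mul, ← intervalIntegral.integral_of_le hη0.le, integral_rpow (Or.inl hm'),
        Real.zero_rpow (by linarith), show (m - 3 / 2 + 1 : ℝ) = m - 1 / 2 by ring, sub_zero]
      ring
    exact h1.trans h2.le
  exact hmaster.trans (add_le_add hdeep le_rfl)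

include hMuntz in
/-- **THEOREM F3, floor form.** If in addition the fringe `E/(m−½)·(e^{−A}/λ)^{m−½}` is at most
`‖W(γ)‖/2`, then `T_λ(F) ≥ ‖W(γ)‖²/(4A)` — with `A = log(Λ/λ) + O(1/m)` this is the `1/log`-floor
whose logarithm is the SPECTRAL EDGE of the leakage, not `log(1/ε)`. -/
theorem latticeTail_ge_of_tailDecay {γ : ℝ} (hγ : riemannZeta (1 / 2 + γ * I) = 0)
    {Λ E m : ℝ} (hm : 1 / 2 < m) (hΛ : lam ≤ Λ)
    (hθ : ∀ u ∈ Ioc 0 (1 / Λ), ‖dilationSum lam F u‖ ≤ E * u ^ (m - 1)) {A : ℝ} (hA : 0 < A)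
    (hAΛ : Real.log (Λ / lam) ≤ A)
    (hfringe : E / (m - 1 / 2) * (Real.exp (-A) / lam) ^ (m - 1 / 2) ≤
      ‖mellin ((Ioi (1 / lam)).indicator (dilationSum lam F)) (1 / 2 + γ * I)‖ / 2) :
    ‖mellin ((Ioi (1 / lam)).indicator (dilationSum lam F)) (1 / 2 + γ * I)‖ ^ 2 / (4 * A) ≤
      latticeTail lam F := by
  set w := ‖mellin ((Ioi (1 / lam)).indicator (dilationSum lam F)) (1 / 2 + γ * I)‖ with hw
  have hT0 : 0 ≤ latticeTail lam F := integral_nonneg fun u ↦ by positivity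
  have h := norm_windowMellin_le_of_tailDecay hlam hFm hB hMuntz hγ hm hΛ hθ hA hAΛ
  have h1 : w / 2 ≤ Real.sqrt (A * latticeTail lam F) := by linarith
  have hw0 : 0 ≤ w := norm_nonneg _
  have h2 : (w / 2) ^ 2 ≤ A * latticeTail lam F := by
    calc (w / 2) ^ 2 ≤ Real.sqrt (A * latticeTail lam F) ^ 2 := by gcongr
      _ = A * latticeTail lam F := Real.sq_sqrt (by positivity)
  rw [div_le_iff₀ (by positivity)]
  nlinarith

end FloorWeighted

end LatticeUncertainty

end Summit.RiemannHypothesis.RiemannHypothesis.Theorems
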